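import Summits.QuantumFields.YangMills.Theorems.VirialFluxGapRegularityCutoffWeights
import HarnessLib

/-!
# Route `VirialFluxGap` (YangMills): the SIGNED CROSS TERM of the patching — `Σ_j ∂_jχ_reg·(c¹_j − c²_j) = Σ_k w_k·[Σ_j (c¹_j − c²_j)·∂_j m_k]`
# with non-negative weights, so one-sided bounds on the four mass-brackets give the one-sided cross bound of `patch_div_le_signed`

Toward ⟨stmt-QuantumFields-24141⟩ `VirialFluxGap.PeriodicSoftness`; referee ruling LEAD g92 (2026-08-31T02:02Z): the cross term of the divergence budget
must be bounded BY SIGN.  ✓`RegCutoff.exists_regCutoff_weights` (w2 g52) writes `∂_Y χ_reg = Σ_{k<3} w_k ∂_Y m_k + w_s ∂_Y m_s` with weights `w ∈ [0, C/ρ²]`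
independent of the direction; hence for ANY two coefficient families

  `Σ_j ∂_jχ_reg(M)·(c¹_j − c²_j)(M) = Σ_k w_k(M)·B_k(M) + w_s(M)·B_s(M)`,  `B_k := Σ_j (c¹_j − c²_j)(M)·∂_j m_k(M)`

(`cross_term_eq_weighted_brackets`), and ★★ `cross_term_signed_le`: if every bracket is `≤ e` (ONE-SIDED; `e ≥ 0` — the pieces' action on the masses:
generic `|Σ_j c¹_j∂_jm_k| = O(√t₀)`, central `Σ_j c²_j∂_jm_k ≥ −N√F₀` by the radial monotonicity `z·∂_z m = 2m ≥ 0`, fcl-p3 g41's (P4)) then the cross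
term is `≤ 4·(C/ρ²)·e`.  Also `cross_term_abs_le` (two-sided version) and `bracket_split` (`B_k = Σ_j c¹_j∂_jm_k − Σ_j c²_j∂_jm_k`).

HONEST FRAMING: algebra (theorems only, 0 `def`, 0 `sorry`, standard axioms); the brackets' bounds, the central field and the assembly are NOT here; ⟨24141⟩
and ⟨22884⟩ stay OPEN; no stub ∕ crux ∕ rung ∕ summit is closed; the Yang–Mills mass gap is NOT proved; no summit is proved by a line.
Width seat `ym-line-sfw-p2-w2` g52 (cell ym-idea-1, free hands), `--supports stmt-QuantumFields-24141`.  References: [folklore].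
-/

set_option autoImplicit false

noncomputable section

open scoped Matrix BigOperators ContDiff Topology
open MeasureTheory
open Literature.MathematicalPhysics.QuantumFieldTheory hiding SU2
open Literature.MathematicalPhysics.QuantumLattice
open Literature.MathematicalPhysics.QuantumFieldTheory.SUNBakryEmery (expSU coe_expSU matTop)

namespace Summit.QuantumFields.YangMills.Theorems.VirialFluxGap.RegCutoff

open Summit.QuantumFields.YangMills.Theorems.FemtoTransferGap
open Summit.QuantumFields.YangMills.Theorems.FemtoTransferGap.TT
open Summit.QuantumFields.YangMills.Theorems.VirialFluxGap.RingDeficit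
open Summit.QuantumFields.YangMills.Theorems.VirialFluxGap.FrameDerivative
open Summit.QuantumFields.YangMills.Theorems.VirialFluxGap.FrameHessian

variable {L : ℕ} [NeZero L]
variable {ι : Type*} [Fintype ι]

open scoped Matrix.Norms.Frobenius

attribute [local instance 2000] Literature.MathematicalPhysics.QuantumFieldTheory.SUNBakryEmery.matTop

omit [NeZero L] in
/-- ★ **The cross term through the mass brackets**: if `∂_{τ_j}χ(M) = Σ_k w_k·∂_{τ_j}m_k(M) + w_s·∂_{τ_j}m_s(M)` for every `j` (weights independent of
`j`), then `Σ_j ∂_jχ·d_j = Σ_k w_k·(Σ_j d_j·∂_jm_k) + w_s·(Σ_j d_j·∂_jm_s)` for any `d` (take `d_j = c¹_j(M) − c²_j(M)`). [folklore] -/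
theorem cross_term_eq_weighted_brackets (τ : ι → ((Fin (2 * L - 1 + 1) × Edge 3 L) ⊕ Site 3 L) → Matrix (Fin 2) (Fin 2) ℂ)
    {χ ms : ((Fin (2 * L - 1 + 1) → Edge 3 L → Matrix (Fin 2) (Fin 2) ℂ) × (Site 3 L → Matrix (Fin 2) (Fin 2) ℂ)) → ℝ}
    {m : Fin 3 → ((Fin (2 * L - 1 + 1) → Edge 3 L → Matrix (Fin 2) (Fin 2) ℂ) × (Site 3 L → Matrix (Fin 2) (Fin 2) ℂ)) → ℝ}
    {M : (Fin (2 * L - 1 + 1) → Edge 3 L → Matrix (Fin 2) (Fin 2) ℂ) × (Site 3 L → Matrix (Fin 2) (Fin 2) ℂ)} {w : Fin 3 → ℝ} {ws : ℝ}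
    (hid : ∀ j, frameD (τ j) χ M = (∑ k : Fin 3, w k * frameD (τ j) (m k) M) + ws * frameD (τ j) ms M) (d : ι → ℝ) :
    ∑ j, frameD (τ j) χ M * d j =
      (∑ k : Fin 3, w k * ∑ j, d j * frameD (τ j) (m k) M) + ws * ∑ j, d j * frameD (τ j) ms M := by
  simp only [hid, Finset.mul_sum, add_mul, Finset.sum_add_distrib, Finset.sum_mul]
  rw [Finset.sum_comm]
  congr 1
  · exact Finset.sum_congr rfl fun j _ => Finset.sum_congr rfl fun k _ => by ring
  · exact Finset.sum_congr rfl fun j _ => by ring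

/-- The bracket of a difference splits: `Σ_j (c¹_j − c²_j)·∂_jm = Σ_j c¹_j·∂_jm − Σ_j c²_j·∂_jm`. [folklore] -/
theorem bracket_split (a b e : ι → ℝ) : ∑ j, (a j - b j) * e j = ∑ j, a j * e j - ∑ j, b j * e j := by
  rw [← Finset.sum_sub_distrib]
  exact Finset.sum_congr rfl fun j _ => by ring

omit [NeZero L] in
/-- ★★ **The ONE-SIDED cross bound**: non-negative weights `w_k, w_s ≤ W` and brackets `≤ e` (`e ≥ 0`) give `Σ_j ∂_jχ·d_j ≤ 4·W·e`. [folklore] -/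
theorem cross_term_signed_le (τ : ι → ((Fin (2 * L - 1 + 1) × Edge 3 L) ⊕ Site 3 L) → Matrix (Fin 2) (Fin 2) ℂ)
    {χ ms : ((Fin (2 * L - 1 + 1) → Edge 3 L → Matrix (Fin 2) (Fin 2) ℂ) × (Site 3 L → Matrix (Fin 2) (Fin 2) ℂ)) → ℝ}
    {m : Fin 3 → ((Fin (2 * L - 1 + 1) → Edge 3 L → Matrix (Fin 2) (Fin 2) ℂ) × (Site 3 L → Matrix (Fin 2) (Fin 2) ℂ)) → ℝ}
    {M : (Fin (2 * L - 1 + 1) → Edge 3 L → Matrix (Fin 2) (Fin 2) ℂ) × (Site 3 L → Matrix (Fin 2) (Fin 2) ℂ)} {w : Fin 3 → ℝ} {ws W e : ℝ}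
    (hid : ∀ j, frameD (τ j) χ M = (∑ k : Fin 3, w k * frameD (τ j) (m k) M) + ws * frameD (τ j) ms M)
    (hw : ∀ k, 0 ≤ w k ∧ w k ≤ W) (hws : 0 ≤ ws ∧ ws ≤ W) (he : 0 ≤ e) (d : ι → ℝ)
    (hBk : ∀ k, ∑ j, d j * frameD (τ j) (m k) M ≤ e) (hBs : ∑ j, d j * frameD (τ j) ms M ≤ e) :
    ∑ j, frameD (τ j) χ M * d j ≤ 4 * W * e := by
  rw [cross_term_eq_weighted_brackets τ hid d, Fin.sum_univ_three]
  have h0 := mul_le_mul_of_nonneg_left (hBk 0) (hw 0).1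
  have h1 := mul_le_mul_of_nonneg_left (hBk 1) (hw 1).1
  have h2 := mul_le_mul_of_nonneg_left (hBk 2) (hw 2).1
  have h3 := mul_le_mul_of_nonneg_left hBs hws.1
  have g0 := mul_le_mul_of_nonneg_right (hw 0).2 he
  have g1 := mul_le_mul_of_nonneg_right (hw 1).2 he
  have g2 := mul_le_mul_of_nonneg_right (hw 2).2 he
  have g3 := mul_le_mul_of_nonneg_right hws.2 he
  linarith

omit [NeZero L] in
/-- The TWO-SIDED cross bound (when the brackets are small in absolute value): `|Σ_j ∂_jχ·d_j| ≤ 4·W·e`. [folklore] -/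
theorem cross_term_abs_le (τ : ι → ((Fin (2 * L - 1 + 1) × Edge 3 L) ⊕ Site 3 L) → Matrix (Fin 2) (Fin 2) ℂ)
    {χ ms : ((Fin (2 * L - 1 + 1) → Edge 3 L → Matrix (Fin 2) (Fin 2) ℂ) × (Site 3 L → Matrix (Fin 2) (Fin 2) ℂ)) → ℝ}
    {m : Fin 3 → ((Fin (2 * L - 1 + 1) → Edge 3 L → Matrix (Fin 2) (Fin 2) ℂ) × (Site 3 L → Matrix (Fin 2) (Fin 2) ℂ)) → ℝ}
    {M : (Fin (2 * L - 1 + 1) → Edge 3 L → Matrix (Fin 2) (Fin 2) ℂ) × (Site 3 L → Matrix (Fin 2) (Fin 2) ℂ)} {w : Fin 3 → ℝ} {ws W e : ℝ}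
    (hid : ∀ j, frameD (τ j) χ M = (∑ k : Fin 3, w k * frameD (τ j) (m k) M) + ws * frameD (τ j) ms M)
    (hw : ∀ k, 0 ≤ w k ∧ w k ≤ W) (hws : 0 ≤ ws ∧ ws ≤ W) (d : ι → ℝ)
    (hBk : ∀ k, |∑ j, d j * frameD (τ j) (m k) M| ≤ e) (hBs : |∑ j, d j * frameD (τ j) ms M| ≤ e) :
    |∑ j, frameD (τ j) χ M * d j| ≤ 4 * W * e := by
  have he : 0 ≤ e := (abs_nonneg _).trans hBs
  rw [abs_le]
  constructor
  · -- lower bound: apply the signed bound to `−d`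
    have hneg := cross_term_signed_le τ hid hw hws he (fun j => -d j)
      (fun k => by
        have := hBk k; rw [abs_le] at this
        have e1 : ∑ j, -d j * frameD (τ j) (m k) M = -∑ j, d j * frameD (τ j) (m k) M := by
          rw [← Finset.sum_neg_distrib]; exact Finset.sum_congr rfl fun j _ => by ring
        rw [e1]; linarith [this.1])
      (by
        rw [abs_le] at hBs
        have e1 : ∑ j, -d j * frameD (τ j) ms M = -∑ j, d j * frameD (τ j) ms M := by
          rw [← Finset.sum_neg_distrib]; exact Finset.sum_congr rfl fun j _ => by ring
        rw [e1]; linarith [hBs.1])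
    have e2 : ∑ j, frameD (τ j) χ M * -d j = -∑ j, frameD (τ j) χ M * d j := by
      rw [← Finset.sum_neg_distrib]; exact Finset.sum_congr rfl fun j _ => by ring
    rw [e2] at hneg
    linarith
  · exact cross_term_signed_le τ hid hw hws he d (fun k => (le_abs_self _).trans (hBk k)) ((le_abs_self _).trans hBs)

/-- ★★ **The signed cross bound for `χ_reg` directly**: with the absolute constant `C` of ✓`exists_regCutoff_weights` (so `W = C/ρ²`), brackets `≤ e`
against the three link masses and the seam mass give `Σ_j ∂_jχ_reg·d_j ≤ 4·(C/ρ²)·e`. [folklore] -/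
theorem cross_term_regCutoff_signed_le : ∃ C : ℝ, 0 ≤ C ∧ ∀ (L : ℕ) [NeZero L] (ρ : ℝ), 0 < ρ → ∀ {ι : Type*} [Fintype ι]
    (τ : ι → ((Fin (2 * L - 1 + 1) × Edge 3 L) ⊕ Site 3 L) → Matrix (Fin 2) (Fin 2) ℂ)
    (M : (Fin (2 * L - 1 + 1) → Edge 3 L → Matrix (Fin 2) (Fin 2) ℂ) × (Site 3 L → Matrix (Fin 2) (Fin 2) ℂ)) (d : ι → ℝ) {e : ℝ}, 0 ≤ e →
      (∀ k : Fin 3, ∑ j, d j * frameD (τ j) (linkMass k) M ≤ e) → (∑ j, d j * frameD (τ j) seamMass M ≤ e) →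
      ∑ j, frameD (τ j) (regCutoff ρ) M * d j ≤ 4 * (C / ρ ^ 2) * e := by
  obtain ⟨C, hC0, hC⟩ := exists_regCutoff_weights
  refine ⟨C, hC0, fun L _ ρ hρ ι _ τ M d e he hBk hBs => ?_⟩
  obtain ⟨w, ws, hw, hws, hid⟩ := hC L ρ hρ M
  exact cross_term_signed_le τ (m := fun k => linkMass k) (ms := seamMass) (fun j => hid (τ j)) hw hws he d hBk hBs

end Summit.QuantumFields.YangMills.Theorems.VirialFluxGap.RegCutoff

end
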